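import Mathlib.CategoryTheory.Limits.FormalCoproducts.Basic
import Mathlib.CategoryTheory.ObjectProperty.FullSubcategory
import Literature.AlgebraicGeometry.Frobenioids.Categories
import Literature.AlgebraicGeometry.Frobenioids.CoproductCompletion
import Literature.AlgebraicGeometry.Frobenioids.CoproductCompletionConnected
import HarnessLib

/-!
# Frobenioids I, §0 p. 16: `C` totally epimorphic ⇒ `C^⊥`, `C^⊤` almost totally epimorphic

Mochizuki, *The geometry of Frobenioids I: the general theory*, Kyushu J. Math. **62** (2008)
293–400, §0 "Categories", kurims text p. 16 [cite: MochizukiFrdI2008, §0 p.16]: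

> "If `C` is a totally epimorphic category, then `C^⊥` (respectively, `C^⊤`) is an almost totally
> epimorphic category of finitely (respectively, countably) connected type."

This file proves the "almost totally epimorphic" half (the last of abc-iut-found's named p. 16
deferrals of `Categories.lean`; the "of finitely connected type" half is `CoproductCompletionFinite`):
an arrow `{Aᵢ}_{i ∈ I} → {Bⱼ}_{j ∈ J}` of `C^⊥`/`C^⊤` with nonempty domain (`I ≠ ∅`) and connected
codomain (`J` a singleton, `isConnectedObj_iff_finiteCoproductCompletion`) is an epimorphism, because
its component `A_{i₀} → B_j` is an epimorphism of `C`. Theorems only.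
-/

namespace Literature.AlgebraicGeometry.Frobenioids

open CategoryTheory CategoryTheory.Limits

universe w v u

variable {C : Type u} [Category.{v} C]

namespace CoproductCompletion

/-- In a full subcategory of `FormalCoproduct C` over a totally epimorphic `C`, an arrow
`f : {Aᵢ} → {Bⱼ}` whose domain has an index `i₀` and whose codomain has at most one index is an
epimorphism: two arrows `g, h` out of `{Bⱼ}` with `f ≫ g = f ≫ h` have the same index map (evaluate at
`j = f(i₀)`) and the same components (cancel the epimorphism `A_{i₀} → B_{f(i₀)}` of `C`).
[cite: MochizukiFrdI2008, §0 p.16] -/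
theorem epi_of_subsingleton_index (hC : IsTotallyEpimorphic C)
    {P : ObjectProperty (FormalCoproduct.{w} C)} {A B : P.FullSubcategory} (f : A ⟶ B)
    [hA : Nonempty A.obj.I] [Subsingleton B.obj.I] : Epi f := by
  refine ⟨fun {Z} g h hgh => ?_⟩
  obtain ⟨i₀⟩ := hA
  obtain ⟨hf, hcomp⟩ :=
    (FormalCoproduct.hom_ext_iff _ _).mp (congrArg InducedCategory.Hom.hom hgh)
  apply ObjectProperty.hom_ext
  refine FormalCoproduct.hom_ext ?_ ?_
  · funext b
    obtain rfl : b = f.hom.f i₀ := Subsingleton.elim _ _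
    exact congrFun hf i₀
  · intro b
    obtain rfl : b = f.hom.f i₀ := Subsingleton.elim _ _
    haveI := hC.epi (f.hom.φ i₀)
    have key : (f.hom.φ i₀ ≫ g.hom.φ (f.hom.f i₀)) ≫ eqToHom _ =
        f.hom.φ i₀ ≫ h.hom.φ (f.hom.f i₀) := hcomp i₀
    rw [← cancel_epi (f.hom.φ i₀), ← Category.assoc]
    exact key

end CoproductCompletion

open CoproductCompletion

/-- **FrdI §0 p. 16:** if `C` is totally epimorphic, then `C^⊥` is almost totally epimorphic —
arrows with nonempty domain and connected (= one-index) codomain are epimorphisms.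
[cite: MochizukiFrdI2008, §0 p.16] -/
theorem IsTotallyEpimorphic.isAlmostTotallyEpimorphic_finiteCoproductCompletion
    (hC : IsTotallyEpimorphic C) :
    IsAlmostTotallyEpimorphic (FiniteCoproductCompletion.{w} C) := by
  refine ⟨fun {A B} f hA hB => ?_⟩
  haveI := nonempty_index_of_isNonemptyObj hA
  haveI := ((isConnectedObj_iff_finiteCoproductCompletion B).mp hB).2
  exact epi_of_subsingleton_index hC f

/-- **FrdI §0 p. 16:** if `C` is totally epimorphic, then `C^⊤` is almost totally epimorphic.
[cite: MochizukiFrdI2008, §0 p.16] -/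
theorem IsTotallyEpimorphic.isAlmostTotallyEpimorphic_countableCoproductCompletion
    (hC : IsTotallyEpimorphic C) :
    IsAlmostTotallyEpimorphic (CountableCoproductCompletion.{w} C) := by
  refine ⟨fun {A B} f hA hB => ?_⟩
  haveI := nonempty_index_of_isNonemptyObj hA
  haveI := ((isConnectedObj_iff_countableCoproductCompletion B).mp hB).2
  exact epi_of_subsingleton_index hC f

end Literature.AlgebraicGeometry.Frobenioids
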